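/-
Copyright (c) 2026. All rights reserved.
Released under Apache 2.0 license as described in the file LICENSE.
Authors: abc-iut cell, wave-5 discharge seat abc-iut-w5-d216 (gen 5) (proof-only: the real `log_k̄` of
abc-iut-L6-d2's `MLFClosure.galoisPadicLog` UNFOLDED — it is the Iwasawa logarithm `padicLogAlgCl` of `ℚ̄_p`
transported along an identification `k̄ ≃ₐ[ℚ_p] ℚ̄_p`).
-/
import Literature.AnabelianGeometry.AbsoluteAnabelian.GaloisPadicLogMLF
import Literature.AnabelianGeometry.AbsoluteAnabelian.GaloisPadicLogPowers
import HarnessLib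

/-!
# [AbsTopIII] Def 3.1 (i): `MLFClosure.galoisPadicLog` is `padicLogAlgCl` read through `k̄ ≃ ℚ̄_p`

S. Mochizuki, *Topics in absolute anabelian geometry III* [MochizukiAbsTopIII2015], Def 3.1 (i), p. 66 l. 21–27:
"the [`p`-adic …] logarithm determines a `Π_k`-equivariant isomorphism `log_k̄ : k~ ⥲ k̄`".  abc-iut-L6-d2
(`GaloisPadicLogMLF.lean`) inhabited abc-iut-L4-t2's hypothesis structure `GaloisPadicLog k k̄` for EVERY
`C : MLFClosure.{0}` as `MLFClosure.galoisPadicLog C`: the tree's Iwasawa logarithm `padicLogAlgCl p` on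
`ℚ̄_p = PadicAlgCl p` (`p` the residue characteristic of `k`, `ℚ_p → k` the canonical `LocalField.padicAlgebra`)
transported along Mathlib's `IsAlgClosure.equiv ℚ_[p] k̄ ℚ̄_p` (`GaloisPadicLog.comap`).  The construction is a
`def` whose body installs its instances with `letI`; consumers that must COMPUTE with `log_k̄` (e.g. compare it on
the base field `k` with the analytic logarithm of campaign S) need the defining formula as a theorem.  THIS
PROOF-ONLY FILE records it (definitional unfolding, no mathematics):

* `MLFClosure.exists_algEquiv_galoisPadicLogOfResidueChar_log_eq` — for every prime `p` with `|p|_k < 1` there is a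
  `ℚ_p`-algebra isomorphism `e : k̄ ≃ₐ[ℚ_p] ℚ̄_p` (for the `ℚ_p`-structure `ℚ_p → k → k̄`) with
  `(C.galoisPadicLogOfResidueChar p _).log x = e.symm (padicLogAlgCl p (e x))` for ALL `x : k̄`;
* `MLFClosure.exists_algEquiv_galoisPadicLog_log_eq` — the same for `C.galoisPadicLog` at `p = C.residueChar`.

Classical; no definitions; nothing here bears on [IUTchIII] Cor. 3.12; typed ≠ discharged.
-/

set_option autoImplicit false

noncomputable section

namespace Literature.AnabelianGeometry.AbsoluteAnabelian

open ValuativeRel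
open scoped ValuativeRel
open Literature.NumberTheory.Transcendental Literature.NumberTheory.GaloisRepresentations

namespace MLFClosure

variable (C : MLFClosure.{0})

/-- **`log_k̄` unfolded, at a residue characteristic `p`**: for the `ℚ_p`-algebra structures `ℚ_p → k`
(`LocalField.padicAlgebra`) and `ℚ_p → k → k̄`, there is a `ℚ_p`-algebra isomorphism `e : k̄ ≃ₐ[ℚ_p] ℚ̄_p` such that
abc-iut-L6-d2's `C.galoisPadicLogOfResidueChar p` is `x ↦ e⁻¹ (log_{ℚ̄_p} (e x))` with `log_{ℚ̄_p} = padicLogAlgCl p`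
(the tree's Iwasawa logarithm). [cite: MochizukiAbsTopIII2015, Definition 3.1 (i) p.66] -/
theorem exists_algEquiv_galoisPadicLogOfResidueChar_log_eq (p : ℕ) [Fact p.Prime] (hpk : valuation C.k p < 1) :
    letI : Algebra ℚ_[p] C.k := LocalField.padicAlgebra C.k p hpk
    letI : Algebra ℚ_[p] C.K := ((algebraMap C.k C.K).comp (LocalField.padicRingHom C.k p hpk)).toAlgebra
    ∃ e : C.K ≃ₐ[ℚ_[p]] PadicAlgCl p, ∀ x : C.K,
      (C.galoisPadicLogOfResidueChar p hpk).log x = e.symm (padicLogAlgCl p (e x)) := by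
  letI iQk : Algebra ℚ_[p] C.k := LocalField.padicAlgebra C.k p hpk
  letI iQK : Algebra ℚ_[p] C.K := ((algebraMap C.k C.K).comp (LocalField.padicRingHom C.k p hpk)).toAlgebra
  haveI : IsScalarTower ℚ_[p] C.k C.K := IsScalarTower.of_algebraMap_eq fun _ => rfl
  haveI : FiniteDimensional ℚ_[p] C.k :=
    Literature.NumberTheory.PAdicHodge.PadicBase.instFiniteDimensional (F := C.k) (p := p) hpk
  haveI : IsAlgClosure ℚ_[p] C.K :=
    { isAlgClosed := IsAlgClosure.isAlgClosed C.k
      isAlgebraic := C.isAlgebraic_padic_K p hpk }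
  exact ⟨IsAlgClosure.equiv ℚ_[p] C.K (PadicAlgCl p), fun x => rfl⟩

/-- **`log_k̄` unfolded** ([AbsTopIII] Def 3.1 (i) for every `MLFClosure`, abc-iut-L6-d2's `MLFClosure.galoisPadicLog`):
with `p := C.residueChar` (the residue characteristic of `k`) and the canonical `ℚ_p`-structures, some
`e : k̄ ≃ₐ[ℚ_p] ℚ̄_p` has `C.galoisPadicLog.log x = e.symm (padicLogAlgCl p (e x))` for all `x : k̄`.
[cite: MochizukiAbsTopIII2015, Definition 3.1 (i) p.66] -/
theorem exists_algEquiv_galoisPadicLog_log_eq :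
    haveI := C.fact_residueChar_prime
    letI : Algebra ℚ_[C.residueChar] C.k := LocalField.padicAlgebra C.k C.residueChar C.valuation_ringChar_lt_one
    letI : Algebra ℚ_[C.residueChar] C.K :=
      ((algebraMap C.k C.K).comp (LocalField.padicRingHom C.k C.residueChar C.valuation_ringChar_lt_one)).toAlgebra
    ∃ e : C.K ≃ₐ[ℚ_[C.residueChar]] PadicAlgCl C.residueChar, ∀ x : C.K,
      C.galoisPadicLog.log x = e.symm (padicLogAlgCl C.residueChar (e x)) :=
  haveI := C.fact_residueChar_prime
  C.exists_algEquiv_galoisPadicLogOfResidueChar_log_eq C.residueChar C.valuation_ringChar_lt_one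

end MLFClosure

end Literature.AnabelianGeometry.AbsoluteAnabelian

end
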